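import Summits.AtomisticToContinuum.HydrodynamicLimit.Theorems.TwoClocksEquilibriumFastWindowLDNormalFormClosure
import Summits.AtomisticToContinuum.HydrodynamicLimit.Theorems.TwoClocksEquilibriumFastWindowLDBaireUniformity

/-!
# `EquilibriumFastWindowLD` is equivalent to its bounded-class normal form
(crux stmt-AtomisticToContinuum-14440 `TwoClocks.EquilibriumFastWindowLD`, line `Sketch`; lead c4)

Helper file (`--supports stmt-AtomisticToContinuum-14440`). The line `Sketch` reduced the crux to
`W` — the crux RESTRICTED to the bounded class `𝒢(C')` (continuous `G`, `|G(x,v)| ≤ C'(1+|v|²)`,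
compact `v`-support, `M_{1,u₀,θ₀}`-orthogonal at every `x` to `1, v_j, |v|²`) but with a tilt range
`β₁(C')` UNIFORM over the class (`EquilibriumFastWindowLD_of_boundedWindowLD`, p125773) — and `W` to
the entropy form `P` (`stub_tiltDuality` p127451, converse p127561). This file proves the missing
direction

* `boundedWindowLD_of_EquilibriumFastWindowLD : EquilibriumFastWindowLD → W`,

so that `W`, `P` and the crux are EQUIVALENT: the registered open stub of the line is the crux
itself, up to kernel-checked statics. The content is AUTOMATIC UNIFORMITY of the tilt range: the
crux gives each admissible `F` its own `β₀(F) > 0`; uniformity over weighted sup-norm balls follows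
from the Baire category theorem (`exists_uniform_range_of_baire`) run on the closed subspace of
encoded admissible observables `f = F/(1+|v|²)` of the Banach space `𝕋³ × ℝ³ →ᵇ ℝ`
(`isClosed_fastClass`), for the predicate "the window bound holds on the tilt range `b`, eventually
in the window" (`windowMoment_eventually_of_exists` makes the crux's `∃ τ` eventual, so that two
observables always have a common good window; algebra and closure of the predicate:
`TwoClocksEquilibriumFastWindowLDNormalFormClosure`):

* `exists_windowGood_of_fastWindowLD` — cover: the crux's conclusion for `F = f(1+|v|²)`, made
  eventual;
* `boundedWindowLD_of_EquilibriumFastWindowLD` — Baire (cover, antitone, closure, sum, symmetry,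
  scaling) gives a range uniform on `{‖f‖ ≤ C'}`; decoding `G = f(1+|v|²)` gives `W`.

No dynamics is used: the equivalence certifies that the line `Sketch` isolates nothing smaller
than the crux (its one open stub `stub_perturbativeRelaxation` ⟺ `W` ⟺ `EquilibriumFastWindowLD`).
-/

noncomputable section

open MeasureTheory ProbabilityTheory Real Set Filter
open scoped ENNReal BigOperators BoundedContinuousFunction

namespace Summit.AtomisticToContinuum.HydrodynamicLimit.Theorems.FastWindowRG

open Literature.Analysis.FluidPDE Literature.MathematicalPhysics.KineticTheory

/-! ### Cover: the crux's conclusion, made eventual in the window -/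

/-- **Cover.** The crux's conclusion at fixed `(a₀, θ₀, u₀, σ, Φ)` gives, for every encoded
admissible `f`, a tilt range on which the window bound of `f ω` holds EVENTUALLY in the window
(`windowMoment_eventually_of_exists` with the static one-site bound of `stub_oneSiteGauss` at growth
`‖f‖`). -/
theorem exists_windowGood_of_fastWindowLD {a₀ θ₀ : ℝ} (ha : 0 < a₀) (hθ : 0 < θ₀) (u₀ : V3) {σ : ℝ}
    (hσ2 : σ ≤ 1 / 2)
    (Φ : (N : ℕ) → HardSphereFlow (Torus.geometry (Fin 3)) (hsDiameter σ N) (N + 1))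
    (hE : ∀ F : T3 × V3 → ℝ, Continuous F → (∃ C : ℝ, ∀ y, |F y| ≤ C * (1 + ‖y.2‖ ^ 2)) →
      (∀ x, ∫ v, F (x, v) * localMaxwellian 1 θ₀ u₀ v = 0) →
      (∀ x (j : Fin 3), ∫ v, F (x, v) * v j * localMaxwellian 1 θ₀ u₀ v = 0) →
      (∀ x, ∫ v, F (x, v) * ‖v‖ ^ 2 * localMaxwellian 1 θ₀ u₀ v = 0) →
      ∃ β₀ : ℝ, 0 < β₀ ∧ ∀ β : ℝ, |β| ≤ β₀ → ∀ ε : ℝ, 0 < ε → ∃ τ : ℝ, 0 < τ ∧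
        ∃ N₀ : ℕ, ∀ N : ℕ, N₀ ≤ N →
          ∫⁻ z, ENNReal.ofReal (Real.exp (β * ∑ i : Fin (N + 1),
            (τ * ((N : ℝ) + 1) ^ (-(1 / 3 : ℝ)))⁻¹ *
              ∫ r in (0 : ℝ)..(τ * ((N : ℝ) + 1) ^ (-(1 / 3 : ℝ))), F (((Φ N).flow r z) i)))
          ∂(localGibbsLaw σ (fun _ => a₀) (fun _ => u₀) (fun _ => θ₀) N (Φ N)) ≤
          ENNReal.ofReal (Real.exp (ε * ((N : ℝ) + 1))))
    (f : T3 × V3 →ᵇ ℝ)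
    (hf0 : ∀ x, ∫ v, f (x, v) * (1 + ‖v‖ ^ 2) * localMaxwellian 1 θ₀ u₀ v = 0)
    (hf1 : ∀ x (j : Fin 3), ∫ v, f (x, v) * (1 + ‖v‖ ^ 2) * v j * localMaxwellian 1 θ₀ u₀ v = 0)
    (hf2 : ∀ x, ∫ v, f (x, v) * (1 + ‖v‖ ^ 2) * ‖v‖ ^ 2 * localMaxwellian 1 θ₀ u₀ v = 0) :
    ∃ b : ℝ, 0 < b ∧
    ∀ β : ℝ, |β| ≤ b → ∀ ε : ℝ, 0 < ε → ∃ τ₀ : ℝ, 0 < τ₀ ∧ ∀ τ : ℝ, τ₀ ≤ τ →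
      ∃ N₀ : ℕ, ∀ N : ℕ, N₀ ≤ N →
        ∫⁻ z, ENNReal.ofReal (Real.exp (β * ∑ i : Fin (N + 1),
            (τ * ((N : ℝ) + 1) ^ (-(1 / 3 : ℝ)))⁻¹ *
              ∫ r in (0 : ℝ)..(τ * ((N : ℝ) + 1) ^ (-(1 / 3 : ℝ))), f (((Φ N).flow r z) i) * (1 + ‖(((Φ N).flow r z) i).2‖ ^ 2)))
          ∂(localGibbsLaw σ (fun _ => a₀) (fun _ => u₀) (fun _ => θ₀) N (Φ N)) ≤
          ENNReal.ofReal (Real.exp (ε * ((N : ℝ) + 1))) := by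
  obtain ⟨β₀, hβ₀, H⟩ := hE (fun y => f y * (1 + ‖y.2‖ ^ 2)) (continuous_mul_quadWeight f)
    ⟨‖f‖, abs_mul_quadWeight_le f⟩ hf0 hf1 hf2
  obtain ⟨t₀, ht₀, K, hK, hone⟩ := stub_oneSiteGauss hθ u₀ (norm_nonneg f)
  refine ⟨min β₀ t₀, lt_min hβ₀ ht₀, fun β hβ ε hε => ?_⟩
  obtain ⟨τ, hτ, N₀, hN⟩ := H β (hβ.trans (min_le_left _ _)) (ε / 2) (half_pos hε)
  have hone' : ∀ x : T3, ∫⁻ v, ENNReal.ofReal (Real.exp (β * (f (x, v) * (1 + ‖v‖ ^ 2))))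
      ∂(gaussMeasure u₀ θ₀) ≤ ENNReal.ofReal (Real.exp (K * β ^ 2)) := by
    intro x
    have hm1 : Measurable fun v : V3 => f (x, v) :=
      (f.continuous.comp (Continuous.prodMk_right x)).measurable
    have hm2 : Measurable fun v : V3 => (1 : ℝ) + ‖v‖ ^ 2 := by fun_prop
    exact hone (fun v => f (x, v) * (1 + ‖v‖ ^ 2)) (hm1.mul hm2)
      (fun v => abs_mul_quadWeight_le f (x, v)) (hf0 x) β (hβ.trans (min_le_right _ _))
  have hev := windowMoment_eventually_of_exists ha hθ u₀ hσ2 Φ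
    (F := fun y : T3 × V3 => f y * (1 + ‖y.2‖ ^ 2)) (continuous_mul_quadWeight f) hK hone' hε hτ hN
  exact ⟨τ * (1 + 2 * K * β ^ 2 / ε), by positivity, fun τ' hτ' => ⟨N₀, fun N hNN => hev τ' hτ' N hNN⟩⟩

/-! ### The equivalence -/

/-- **`EquilibriumFastWindowLD` implies its bounded-class normal form `W` with a CLASS-UNIFORM tilt
range** (the converse of `EquilibriumFastWindowLD_of_boundedWindowLD`; automatic uniformity by
Baire category on the closed subspace of encoded admissible observables of `𝕋³ × ℝ³ →ᵇ ℝ`). The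
compact-support clause of `W` is not used. -/
theorem boundedWindowLD_of_EquilibriumFastWindowLD :
    Summit.AtomisticToContinuum.HydrodynamicLimit.Theses.TwoClocks.EquilibriumFastWindowLD →
    ∃ σ₀ : ℝ, 0 < σ₀ ∧ ∀ (a₀ θ₀ : ℝ) (u₀ : V3), 0 < a₀ → 0 < θ₀ → ∀ σ : ℝ, 0 < σ → σ < σ₀ →
      ∀ Φ : (N : ℕ) → HardSphereFlow (Torus.geometry (Fin 3)) (hsDiameter σ N) (N + 1),
      ∀ C' : ℝ, 0 ≤ C' → ∃ β₁ : ℝ, 0 < β₁ ∧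
      ∀ G : T3 × V3 → ℝ, Continuous G → (∀ y, |G y| ≤ C' * (1 + ‖y.2‖ ^ 2)) →
      (∃ R : ℝ, ∀ y : T3 × V3, R ≤ ‖y.2‖ → G y = 0) →
      (∀ x, ∫ v, G (x, v) * localMaxwellian 1 θ₀ u₀ v = 0) →
      (∀ x (j : Fin 3), ∫ v, G (x, v) * v j * localMaxwellian 1 θ₀ u₀ v = 0) →
      (∀ x, ∫ v, G (x, v) * ‖v‖ ^ 2 * localMaxwellian 1 θ₀ u₀ v = 0) →
      ∀ β : ℝ, |β| ≤ β₁ → ∀ ε : ℝ, 0 < ε → ∃ τ : ℝ, 0 < τ ∧ ∃ N₀ : ℕ, ∀ N : ℕ, N₀ ≤ N →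
        ∫⁻ z, ENNReal.ofReal (Real.exp (β * ∑ i : Fin (N + 1),
            (τ * ((N : ℝ) + 1) ^ (-(1 / 3 : ℝ)))⁻¹ *
              ∫ r in (0 : ℝ)..(τ * ((N : ℝ) + 1) ^ (-(1 / 3 : ℝ))), G (((Φ N).flow r z) i)))
          ∂(localGibbsLaw σ (fun _ => a₀) (fun _ => u₀) (fun _ => θ₀) N (Φ N)) ≤
          ENNReal.ofReal (Real.exp (ε * ((N : ℝ) + 1))) := by
  rintro ⟨σ₀, hσ₀, hE⟩
  refine ⟨min σ₀ (1 / 2), lt_min hσ₀ (by norm_num), ?_⟩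
  intro a₀ θ₀ u₀ ha hθ σ hσ hσlt Φ C' hC'
  have hσ₀' : σ < σ₀ := hσlt.trans_le (min_le_left _ _)
  have hσ2 : σ ≤ 1 / 2 := (hσlt.trans_le (min_le_right _ _)).le
  have hEσ := hE a₀ θ₀ u₀ ha hθ σ hσ hσ₀' Φ
  -- the six hypotheses of the Baire lemma for the eventual window bound of `f ω`
  have hcover : ∀ f ∈ {f : T3 × V3 →ᵇ ℝ |
      (∀ x, ∫ v, f (x, v) * (1 + ‖v‖ ^ 2) * localMaxwellian 1 θ₀ u₀ v = 0) ∧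
      (∀ x (j : Fin 3), ∫ v, f (x, v) * (1 + ‖v‖ ^ 2) * v j * localMaxwellian 1 θ₀ u₀ v = 0) ∧
      (∀ x, ∫ v, f (x, v) * (1 + ‖v‖ ^ 2) * ‖v‖ ^ 2 * localMaxwellian 1 θ₀ u₀ v = 0)},
      ∃ b : ℝ, 0 < b ∧
      ∀ β : ℝ, |β| ≤ b → ∀ ε : ℝ, 0 < ε → ∃ τ₀ : ℝ, 0 < τ₀ ∧ ∀ τ : ℝ, τ₀ ≤ τ →
        ∃ N₀ : ℕ, ∀ N : ℕ, N₀ ≤ N →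
          ∫⁻ z, ENNReal.ofReal (Real.exp (β * ∑ i : Fin (N + 1),
              (τ * ((N : ℝ) + 1) ^ (-(1 / 3 : ℝ)))⁻¹ *
                ∫ r in (0 : ℝ)..(τ * ((N : ℝ) + 1) ^ (-(1 / 3 : ℝ))), f (((Φ N).flow r z) i) * (1 + ‖(((Φ N).flow r z) i).2‖ ^ 2)))
            ∂(localGibbsLaw σ (fun _ => a₀) (fun _ => u₀) (fun _ => θ₀) N (Φ N)) ≤
            ENNReal.ofReal (Real.exp (ε * ((N : ℝ) + 1))) :=
    fun f hf => by
      obtain ⟨h0, h1, h2⟩ := hf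
      exact exists_windowGood_of_fastWindowLD ha hθ u₀ hσ2 Φ hEσ f h0 h1 h2
  have hanti : ∀ (b b' : ℝ) (f : T3 × V3 →ᵇ ℝ),
      (∀ β : ℝ, |β| ≤ b → ∀ ε : ℝ, 0 < ε → ∃ τ₀ : ℝ, 0 < τ₀ ∧ ∀ τ : ℝ, τ₀ ≤ τ →
        ∃ N₀ : ℕ, ∀ N : ℕ, N₀ ≤ N →
          ∫⁻ z, ENNReal.ofReal (Real.exp (β * ∑ i : Fin (N + 1),
              (τ * ((N : ℝ) + 1) ^ (-(1 / 3 : ℝ)))⁻¹ *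
                ∫ r in (0 : ℝ)..(τ * ((N : ℝ) + 1) ^ (-(1 / 3 : ℝ))), f (((Φ N).flow r z) i) * (1 + ‖(((Φ N).flow r z) i).2‖ ^ 2)))
            ∂(localGibbsLaw σ (fun _ => a₀) (fun _ => u₀) (fun _ => θ₀) N (Φ N)) ≤
            ENNReal.ofReal (Real.exp (ε * ((N : ℝ) + 1)))) → 0 < b' → b' ≤ b →
      ∀ β : ℝ, |β| ≤ b' → ∀ ε : ℝ, 0 < ε → ∃ τ₀ : ℝ, 0 < τ₀ ∧ ∀ τ : ℝ, τ₀ ≤ τ →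
        ∃ N₀ : ℕ, ∀ N : ℕ, N₀ ≤ N →
          ∫⁻ z, ENNReal.ofReal (Real.exp (β * ∑ i : Fin (N + 1),
              (τ * ((N : ℝ) + 1) ^ (-(1 / 3 : ℝ)))⁻¹ *
                ∫ r in (0 : ℝ)..(τ * ((N : ℝ) + 1) ^ (-(1 / 3 : ℝ))), f (((Φ N).flow r z) i) * (1 + ‖(((Φ N).flow r z) i).2‖ ^ 2)))
            ∂(localGibbsLaw σ (fun _ => a₀) (fun _ => u₀) (fun _ => θ₀) N (Φ N)) ≤
            ENNReal.ofReal (Real.exp (ε * ((N : ℝ) + 1))) :=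
    fun b b' f h _ hbb' β hβ => h β (hβ.trans hbb')
  have hclosure : ∀ b : ℝ, 0 < b → ∀ f ∈ {f : T3 × V3 →ᵇ ℝ |
      (∀ x, ∫ v, f (x, v) * (1 + ‖v‖ ^ 2) * localMaxwellian 1 θ₀ u₀ v = 0) ∧
      (∀ x (j : Fin 3), ∫ v, f (x, v) * (1 + ‖v‖ ^ 2) * v j * localMaxwellian 1 θ₀ u₀ v = 0) ∧
      (∀ x, ∫ v, f (x, v) * (1 + ‖v‖ ^ 2) * ‖v‖ ^ 2 * localMaxwellian 1 θ₀ u₀ v = 0)},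
      (∀ δ : ℝ, 0 < δ → ∃ g ∈ {f : T3 × V3 →ᵇ ℝ |
      (∀ x, ∫ v, f (x, v) * (1 + ‖v‖ ^ 2) * localMaxwellian 1 θ₀ u₀ v = 0) ∧
      (∀ x (j : Fin 3), ∫ v, f (x, v) * (1 + ‖v‖ ^ 2) * v j * localMaxwellian 1 θ₀ u₀ v = 0) ∧
      (∀ x, ∫ v, f (x, v) * (1 + ‖v‖ ^ 2) * ‖v‖ ^ 2 * localMaxwellian 1 θ₀ u₀ v = 0)}, ‖g - f‖ < δ ∧
      ∀ β : ℝ, |β| ≤ b → ∀ ε : ℝ, 0 < ε → ∃ τ₀ : ℝ, 0 < τ₀ ∧ ∀ τ : ℝ, τ₀ ≤ τ →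
        ∃ N₀ : ℕ, ∀ N : ℕ, N₀ ≤ N →
          ∫⁻ z, ENNReal.ofReal (Real.exp (β * ∑ i : Fin (N + 1),
              (τ * ((N : ℝ) + 1) ^ (-(1 / 3 : ℝ)))⁻¹ *
                ∫ r in (0 : ℝ)..(τ * ((N : ℝ) + 1) ^ (-(1 / 3 : ℝ))), g (((Φ N).flow r z) i) * (1 + ‖(((Φ N).flow r z) i).2‖ ^ 2)))
            ∂(localGibbsLaw σ (fun _ => a₀) (fun _ => u₀) (fun _ => θ₀) N (Φ N)) ≤
            ENNReal.ofReal (Real.exp (ε * ((N : ℝ) + 1)))) →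
      ∀ β : ℝ, |β| ≤ b / 2 → ∀ ε : ℝ, 0 < ε → ∃ τ₀ : ℝ, 0 < τ₀ ∧ ∀ τ : ℝ, τ₀ ≤ τ →
        ∃ N₀ : ℕ, ∀ N : ℕ, N₀ ≤ N →
          ∫⁻ z, ENNReal.ofReal (Real.exp (β * ∑ i : Fin (N + 1),
              (τ * ((N : ℝ) + 1) ^ (-(1 / 3 : ℝ)))⁻¹ *
                ∫ r in (0 : ℝ)..(τ * ((N : ℝ) + 1) ^ (-(1 / 3 : ℝ))), f (((Φ N).flow r z) i) * (1 + ‖(((Φ N).flow r z) i).2‖ ^ 2)))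
            ∂(localGibbsLaw σ (fun _ => a₀) (fun _ => u₀) (fun _ => θ₀) N (Φ N)) ≤
            ENNReal.ofReal (Real.exp (ε * ((N : ℝ) + 1))) := by
    intro b hb f hf happ
    obtain ⟨hf0, -, -⟩ := hf
    refine windowGood_of_approx ha hθ u₀ hσ2 Φ hb hf0 fun δ hδ => ?_
    obtain ⟨g, ⟨hg0, -, -⟩, hgf, hgood⟩ := happ δ hδ
    exact ⟨g, hg0, hgf, hgood⟩
  have hsum : ∀ b : ℝ, 0 < b → ∀ f g : T3 × V3 →ᵇ ℝ,
      (∀ β : ℝ, |β| ≤ b → ∀ ε : ℝ, 0 < ε → ∃ τ₀ : ℝ, 0 < τ₀ ∧ ∀ τ : ℝ, τ₀ ≤ τ →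
        ∃ N₀ : ℕ, ∀ N : ℕ, N₀ ≤ N →
          ∫⁻ z, ENNReal.ofReal (Real.exp (β * ∑ i : Fin (N + 1),
              (τ * ((N : ℝ) + 1) ^ (-(1 / 3 : ℝ)))⁻¹ *
                ∫ r in (0 : ℝ)..(τ * ((N : ℝ) + 1) ^ (-(1 / 3 : ℝ))), f (((Φ N).flow r z) i) * (1 + ‖(((Φ N).flow r z) i).2‖ ^ 2)))
            ∂(localGibbsLaw σ (fun _ => a₀) (fun _ => u₀) (fun _ => θ₀) N (Φ N)) ≤
            ENNReal.ofReal (Real.exp (ε * ((N : ℝ) + 1)))) →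
      (∀ β : ℝ, |β| ≤ b → ∀ ε : ℝ, 0 < ε → ∃ τ₀ : ℝ, 0 < τ₀ ∧ ∀ τ : ℝ, τ₀ ≤ τ →
        ∃ N₀ : ℕ, ∀ N : ℕ, N₀ ≤ N →
          ∫⁻ z, ENNReal.ofReal (Real.exp (β * ∑ i : Fin (N + 1),
              (τ * ((N : ℝ) + 1) ^ (-(1 / 3 : ℝ)))⁻¹ *
                ∫ r in (0 : ℝ)..(τ * ((N : ℝ) + 1) ^ (-(1 / 3 : ℝ))), g (((Φ N).flow r z) i) * (1 + ‖(((Φ N).flow r z) i).2‖ ^ 2)))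
            ∂(localGibbsLaw σ (fun _ => a₀) (fun _ => u₀) (fun _ => θ₀) N (Φ N)) ≤
            ENNReal.ofReal (Real.exp (ε * ((N : ℝ) + 1)))) →
      ∀ β : ℝ, |β| ≤ b / 2 → ∀ ε : ℝ, 0 < ε → ∃ τ₀ : ℝ, 0 < τ₀ ∧ ∀ τ : ℝ, τ₀ ≤ τ →
        ∃ N₀ : ℕ, ∀ N : ℕ, N₀ ≤ N →
          ∫⁻ z, ENNReal.ofReal (Real.exp (β * ∑ i : Fin (N + 1),
              (τ * ((N : ℝ) + 1) ^ (-(1 / 3 : ℝ)))⁻¹ *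
                ∫ r in (0 : ℝ)..(τ * ((N : ℝ) + 1) ^ (-(1 / 3 : ℝ))), (f + g) (((Φ N).flow r z) i) * (1 + ‖(((Φ N).flow r z) i).2‖ ^ 2)))
            ∂(localGibbsLaw σ (fun _ => a₀) (fun _ => u₀) (fun _ => θ₀) N (Φ N)) ≤
            ENNReal.ofReal (Real.exp (ε * ((N : ℝ) + 1))) := by
    intro b _ f g hf hg
    have e : ∀ y : T3 × V3, (f + g) y * (1 + ‖y.2‖ ^ 2) =
        f y * (1 + ‖y.2‖ ^ 2) + g y * (1 + ‖y.2‖ ^ 2) := fun y => by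
      rw [BoundedContinuousFunction.add_apply, add_mul]
    simp_rw [e]
    exact windowGood_add σ a₀ θ₀ u₀ Φ (F := fun y : T3 × V3 => f y * (1 + ‖y.2‖ ^ 2))
      (G := fun y : T3 × V3 => g y * (1 + ‖y.2‖ ^ 2)) (continuous_mul_quadWeight f)
      (continuous_mul_quadWeight g) hf hg
  have hneg : ∀ (b : ℝ) (f : T3 × V3 →ᵇ ℝ),
      (∀ β : ℝ, |β| ≤ b → ∀ ε : ℝ, 0 < ε → ∃ τ₀ : ℝ, 0 < τ₀ ∧ ∀ τ : ℝ, τ₀ ≤ τ →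
        ∃ N₀ : ℕ, ∀ N : ℕ, N₀ ≤ N →
          ∫⁻ z, ENNReal.ofReal (Real.exp (β * ∑ i : Fin (N + 1),
              (τ * ((N : ℝ) + 1) ^ (-(1 / 3 : ℝ)))⁻¹ *
                ∫ r in (0 : ℝ)..(τ * ((N : ℝ) + 1) ^ (-(1 / 3 : ℝ))), f (((Φ N).flow r z) i) * (1 + ‖(((Φ N).flow r z) i).2‖ ^ 2)))
            ∂(localGibbsLaw σ (fun _ => a₀) (fun _ => u₀) (fun _ => θ₀) N (Φ N)) ≤
            ENNReal.ofReal (Real.exp (ε * ((N : ℝ) + 1)))) →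
      ∀ β : ℝ, |β| ≤ b → ∀ ε : ℝ, 0 < ε → ∃ τ₀ : ℝ, 0 < τ₀ ∧ ∀ τ : ℝ, τ₀ ≤ τ →
        ∃ N₀ : ℕ, ∀ N : ℕ, N₀ ≤ N →
          ∫⁻ z, ENNReal.ofReal (Real.exp (β * ∑ i : Fin (N + 1),
              (τ * ((N : ℝ) + 1) ^ (-(1 / 3 : ℝ)))⁻¹ *
                ∫ r in (0 : ℝ)..(τ * ((N : ℝ) + 1) ^ (-(1 / 3 : ℝ))), (-f) (((Φ N).flow r z) i) * (1 + ‖(((Φ N).flow r z) i).2‖ ^ 2)))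
            ∂(localGibbsLaw σ (fun _ => a₀) (fun _ => u₀) (fun _ => θ₀) N (Φ N)) ≤
            ENNReal.ofReal (Real.exp (ε * ((N : ℝ) + 1))) := by
    intro b f hf
    have e : ∀ y : T3 × V3, (-f) y * (1 + ‖y.2‖ ^ 2) = -(f y * (1 + ‖y.2‖ ^ 2)) := fun y => by
      rw [BoundedContinuousFunction.neg_apply, neg_mul]
    simp_rw [e]
    exact windowGood_neg σ a₀ θ₀ u₀ Φ (F := fun y : T3 × V3 => f y * (1 + ‖y.2‖ ^ 2)) hf
  have hsmul : ∀ (b c : ℝ) (f : T3 × V3 →ᵇ ℝ), 0 < c →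
      (∀ β : ℝ, |β| ≤ b → ∀ ε : ℝ, 0 < ε → ∃ τ₀ : ℝ, 0 < τ₀ ∧ ∀ τ : ℝ, τ₀ ≤ τ →
        ∃ N₀ : ℕ, ∀ N : ℕ, N₀ ≤ N →
          ∫⁻ z, ENNReal.ofReal (Real.exp (β * ∑ i : Fin (N + 1),
              (τ * ((N : ℝ) + 1) ^ (-(1 / 3 : ℝ)))⁻¹ *
                ∫ r in (0 : ℝ)..(τ * ((N : ℝ) + 1) ^ (-(1 / 3 : ℝ))), f (((Φ N).flow r z) i) * (1 + ‖(((Φ N).flow r z) i).2‖ ^ 2)))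
            ∂(localGibbsLaw σ (fun _ => a₀) (fun _ => u₀) (fun _ => θ₀) N (Φ N)) ≤
            ENNReal.ofReal (Real.exp (ε * ((N : ℝ) + 1)))) →
      ∀ β : ℝ, |β| ≤ b / c → ∀ ε : ℝ, 0 < ε → ∃ τ₀ : ℝ, 0 < τ₀ ∧ ∀ τ : ℝ, τ₀ ≤ τ →
        ∃ N₀ : ℕ, ∀ N : ℕ, N₀ ≤ N →
          ∫⁻ z, ENNReal.ofReal (Real.exp (β * ∑ i : Fin (N + 1),
              (τ * ((N : ℝ) + 1) ^ (-(1 / 3 : ℝ)))⁻¹ *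
                ∫ r in (0 : ℝ)..(τ * ((N : ℝ) + 1) ^ (-(1 / 3 : ℝ))), (c • f) (((Φ N).flow r z) i) * (1 + ‖(((Φ N).flow r z) i).2‖ ^ 2)))
            ∂(localGibbsLaw σ (fun _ => a₀) (fun _ => u₀) (fun _ => θ₀) N (Φ N)) ≤
            ENNReal.ofReal (Real.exp (ε * ((N : ℝ) + 1))) := by
    intro b c f hc hf
    have e : ∀ y : T3 × V3, (c • f) y * (1 + ‖y.2‖ ^ 2) = c * (f y * (1 + ‖y.2‖ ^ 2)) :=
      fun y => by rw [BoundedContinuousFunction.smul_apply, smul_eq_mul, mul_assoc]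
    simp_rw [e]
    exact windowGood_const_mul σ a₀ θ₀ u₀ Φ (F := fun y : T3 × V3 => f y * (1 + ‖y.2‖ ^ 2)) hc hf
  obtain ⟨b, hb, hball⟩ := exists_uniform_range_of_baire (isClosed_fastClass hθ u₀)
    (zero_mem_fastClass θ₀ u₀) (add_mem_fastClass hθ u₀) (neg_mem_fastClass θ₀ u₀)
    (fun c f hf => smul_mem_fastClass θ₀ u₀ c f hf)
    (fun b f => ∀ β : ℝ, |β| ≤ b → ∀ ε : ℝ, 0 < ε → ∃ τ₀ : ℝ, 0 < τ₀ ∧ ∀ τ : ℝ, τ₀ ≤ τ →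
        ∃ N₀ : ℕ, ∀ N : ℕ, N₀ ≤ N →
          ∫⁻ z, ENNReal.ofReal (Real.exp (β * ∑ i : Fin (N + 1),
              (τ * ((N : ℝ) + 1) ^ (-(1 / 3 : ℝ)))⁻¹ *
                ∫ r in (0 : ℝ)..(τ * ((N : ℝ) + 1) ^ (-(1 / 3 : ℝ))), f (((Φ N).flow r z) i) * (1 + ‖(((Φ N).flow r z) i).2‖ ^ 2)))
            ∂(localGibbsLaw σ (fun _ => a₀) (fun _ => u₀) (fun _ => θ₀) N (Φ N)) ≤
            ENNReal.ofReal (Real.exp (ε * ((N : ℝ) + 1))))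
    hcover hanti hclosure hsum hneg hsmul C' hC'
  refine ⟨b, hb, ?_⟩
  intro G hG hGC _hGs hG0 hG1 hG2 β hβ ε hε
  -- decode `G = f ω`, `‖f‖ ≤ C'`, `f` in the class
  obtain ⟨f, hfC, hfG⟩ := exists_boundedContinuous_mul_quadWeight_eq hG hC' hGC
  have hf0 : ∀ x, ∫ v, f (x, v) * (1 + ‖v‖ ^ 2) * localMaxwellian 1 θ₀ u₀ v = 0 := fun x => by
    have e : ∀ v : V3, f (x, v) * (1 + ‖v‖ ^ 2) = G (x, v) := fun v => hfG (x, v)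
    simp_rw [e]; exact hG0 x
  have hf1 : ∀ x (j : Fin 3),
      ∫ v, f (x, v) * (1 + ‖v‖ ^ 2) * v j * localMaxwellian 1 θ₀ u₀ v = 0 := fun x j => by
    have e : ∀ v : V3, f (x, v) * (1 + ‖v‖ ^ 2) = G (x, v) := fun v => hfG (x, v)
    simp_rw [e]; exact hG1 x j
  have hf2 : ∀ x, ∫ v, f (x, v) * (1 + ‖v‖ ^ 2) * ‖v‖ ^ 2 * localMaxwellian 1 θ₀ u₀ v = 0 :=
    fun x => by
    have e : ∀ v : V3, f (x, v) * (1 + ‖v‖ ^ 2) = G (x, v) := fun v => hfG (x, v)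
    simp_rw [e]; exact hG2 x
  obtain ⟨τ₀, hτ₀, H⟩ := hball f ⟨hf0, hf1, hf2⟩ hfC β hβ ε hε
  obtain ⟨N₀, hN⟩ := H τ₀ le_rfl
  refine ⟨τ₀, hτ₀, N₀, fun N hNN => ?_⟩
  have h := hN N hNN
  simp_rw [hfG] at h
  exact h

end Summit.AtomisticToContinuum.HydrodynamicLimit.Theorems.FastWindowRG

end
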